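import Literature.NumberTheory.EllipticCurves.DescendedFrobeniusMatrix
import Literature.NumberTheory.EllipticCurves.FormalMulTwoLowOrderProofs
import Summits.BirchSwinnertonDyer.BirchSwinnertonDyer.Theorems.CyclotomicUntwistNineIntegersStructure
import HarnessLib

/-!
# The ramified substitution estimate over `𝓞 = 𝓞_{ℚ₃(ζ₉)}`: `u ≡ v (mod 1 − ζ₉) ⇒ 3·(ℓ(u) − ℓ(v)) ∈ 𝓞⟦X⟧`
# for every `ℓ ∈ ℚ₃(ζ₉)⟦X⟧` with `m·[Xᵐ]ℓ ∈ 𝓞` (Katz's key lemma after `⊗ ℚ`, without divided powers)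

Cell `pub/bsd-wall`, D-0145 line `route-BirchSwinnertonDyer-CyclotomicUntwist`, lead seat `bsd-line-cycu-p1` (gen 6),
lane «HONDA OVER `𝓞_{ℚ₃(ζ₉)}`» (part 1 of 2; part 2 = `CyclotomicUntwistNineHondaCongruence`) — helpers toward the print
input `WeierstrassCurve.isDescendedFrobeniusMatrix_exists` of the K-SEP child C2 = stmt-BirchSwinnertonDyer-27549
(cruxes K1 `PSRankOneLowerHalfAtThree` = 21580 / K2 = 21581).

Over the UNRAMIFIED ring `ℤ_p`, Honda's/Hazewinkel's estimate `p ∣ u − v ⇒ mp ∣ uᵐ − vᵐ` turns a congruence between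
arguments into a congruence `ℓ(u) ≡ ℓ(v) (mod p)` for any `ℓ` with `m·[Xᵐ]ℓ` integral (tree:
`Literature.RingTheory.FormalGroups.norm_coeff_subst_sub_subst_le_of_natCast_mul_coeff_le`). Over the totally ramified
sextic ring `𝓞 = integralClosure ℤ₃ ℚ₃(ζ₉)` (`e = 6 > p − 1`: the maximal ideal `(1 − ζ₉)` has no divided powers) the
same mechanism survives after `⊗ ℚ` with the loss of exactly ONE factor `3` (`v(πᵐ/m) ≥ −v(3)` for all `m ≥ 1`):

* `natCast_dvd_three_mul_pow_sub_pow` — in a ring with `π² ∣ 3 ∣ π⁶` and the integers prime to `3` invertible,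
  `π ∣ u − v ⇒ m ∣ 3·(uᵐ − vᵐ)` (through `3ᵏπ³ ∣ u^{3^{k+1}} − v^{3^{k+1}}`, `dvd_pow_three_pow_sub`);
* `C_varpi_sq_dvd_three`, `three_dvd_C_varpi_pow_six`, `isUnit_natCast_of_not_dvd` — these hypotheses in `𝓞⟦X⟧`
  (`3 = −(1 − ζ₉)⁶θ⁻¹`, `NineIntegers`); `exists_eq_C_varpi_mul_of_map_eq_zero` — a series killed by a reduction map
  `ρ : 𝓞 → 𝔽₃` is `(1 − ζ₉)`·(an `𝓞`-series) (`ker ρ = (1 − ζ₉)`, `NineIntegers.residueMap_eq_zero_iff`);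
* `three_mul_coeff_subst_sub_subst_mem` — **for `ℓ ∈ ℚ₃(ζ₉)⟦X⟧` with `m·[Xᵐ]ℓ ∈ 𝓞` and `𝓞`-series `U ≡ V
  (mod 1 − ζ₉)` without constant term, `3·[Xⁿ](ℓ(U) − ℓ(V)) ∈ 𝓞` for every `n`** — Katz 1981, Key Lemma 5.1.3
  (independence of the lifting) in the concrete currency of `DescendedFrobeniusMatrix`, modulo bounded denominators.

THEOREMS ONLY (no `def`, no named fact, no `sorry`); BSD is not proved by this file and no crux is.

References: T. Honda, J. Math. Soc. Japan 22 (1970) §2 Lemma 2.3 [Honda1970]; M. Hazewinkel, Formal Groups and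
Applications (1978) I §2.3 [Hazewinkel1978]; N. M. Katz, LNM 868 (1981) §5.1 Key Lemma 5.1.3 [Katz1981CrystallineDieudonne].
-/

-- single-conjunct summit: `Summit.BirchSwinnertonDyer.BirchSwinnertonDyer.…` repeats the name by design
set_option linter.dupNamespace false
set_option autoImplicit false

noncomputable section

open scoped Classical
open PowerSeries IsCyclotomicExtension Literature.NumberTheory.EllipticCurves.DescendedFrobenius
  Summit.BirchSwinnertonDyer.BirchSwinnertonDyer.Theorems.NineIntegers

namespace Summit.BirchSwinnertonDyer.BirchSwinnertonDyer.Theorems.NineHondaEstimate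

/-! ### §1 Pure algebra: `π ∣ u − v ⇒ m ∣ 3(uᵐ − vᵐ)` when `π² ∣ 3 ∣ π⁶` -/

section Algebra

variable {S : Type*} [CommRing S] {π : S}

/-- `u³ − v³ = (u − v)³ + 3uv(u − v)`. [folklore] -/
theorem pow_three_sub_pow_three (u v : S) : u ^ 3 - v ^ 3 = (u - v) ^ 3 + 3 * (u * v * (u - v)) := by
  ring

/-- `π ∣ u − v ⇒ π³ ∣ u³ − v³` when `π² ∣ 3` (the `e = 6` replacement of `p ∣ u − v ⇒ p² ∣ uᵖ − vᵖ`).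
[cite: Honda1970, §2 Lemma 2.3] -/
theorem dvd_pow_three_sub (h2 : π ^ 2 ∣ (3 : S)) {u v : S} (huv : π ∣ u - v) : π ^ 3 ∣ u ^ 3 - v ^ 3 := by
  obtain ⟨c, hc⟩ := huv
  obtain ⟨d, hd⟩ := h2
  rw [pow_three_sub_pow_three, hc, hd]
  exact ⟨c ^ 3 + d * (u * v * c), by ring⟩

/-- `π ∣ u − v ⇒ 3ᵏπ³ ∣ u^{3^{k+1}} − v^{3^{k+1}}` when `π² ∣ 3 ∣ π⁶` (valuations `3, 9, 15, …`).
[cite: Honda1970, §2 Lemma 2.3] -/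
theorem dvd_pow_three_pow_sub (h2 : π ^ 2 ∣ (3 : S)) (h6 : (3 : S) ∣ π ^ 6) {u v : S} (huv : π ∣ u - v)
    (k : ℕ) : 3 ^ k * π ^ 3 ∣ u ^ 3 ^ (k + 1) - v ^ 3 ^ (k + 1) := by
  induction k with
  | zero => rw [pow_zero, one_mul, zero_add, pow_one]; exact dvd_pow_three_sub h2 huv
  | succ k ih =>
    obtain ⟨c, hc⟩ := ih
    obtain ⟨e, he⟩ := h6
    have hu : u ^ 3 ^ (k + 1 + 1) = (u ^ 3 ^ (k + 1)) ^ 3 := by rw [← pow_mul, ← pow_succ]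
    have hv : v ^ 3 ^ (k + 1 + 1) = (v ^ 3 ^ (k + 1)) ^ 3 := by rw [← pow_mul, ← pow_succ]
    rw [hu, hv, pow_three_sub_pow_three, hc]
    have e9 : (3 ^ k * π ^ 3 * c) ^ 3 = 3 ^ (k + 1) * π ^ 3 * (3 ^ (2 * k) * e * c ^ 3) := by
      have : (π ^ 3) ^ 3 = π ^ 3 * (3 * e) := by rw [← he]; ring
      calc (3 ^ k * π ^ 3 * c) ^ 3 = (3 ^ k) ^ 3 * (π ^ 3) ^ 3 * c ^ 3 := by ring
        _ = (3 ^ k) ^ 3 * (π ^ 3 * (3 * e)) * c ^ 3 := by rw [this]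
        _ = 3 ^ (k + 1) * π ^ 3 * (3 ^ (2 * k) * e * c ^ 3) := by ring
    rw [e9]
    exact ⟨3 ^ (2 * k) * e * c ^ 3 + u ^ 3 ^ (k + 1) * v ^ 3 ^ (k + 1) * c, by ring⟩

/-- **`π ∣ u − v ⇒ m ∣ 3·(uᵐ − vᵐ)` for every `m`**, in a ring with `π² ∣ 3 ∣ π⁶` in which the integers prime to
`3` are units (the ramified, `e = 6`, form of Honda's/Hazewinkel's `mp ∣ uᵐ − vᵐ`; ONE factor `3` is lost).
[cite: Honda1970, §2 Lemma 2.3] [cite: Hazewinkel1978, Ch. I §2.3] -/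
theorem natCast_dvd_three_mul_pow_sub_pow (h2 : π ^ 2 ∣ (3 : S)) (h6 : (3 : S) ∣ π ^ 6)
    (hunit : ∀ r : ℕ, ¬ 3 ∣ r → IsUnit (r : S)) {u v : S} (huv : π ∣ u - v) (m : ℕ) :
    (m : S) ∣ 3 * (u ^ m - v ^ m) := by
  rcases eq_or_ne m 0 with rfl | hm
  · simp
  obtain ⟨k, r, hr, rfl⟩ := Nat.exists_eq_pow_mul_and_not_dvd hm 3 (by norm_num)
  have hru : IsUnit (r : S) := hunit r hr
  rcases k with _ | j
  · rw [pow_zero, one_mul]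
    exact hru.dvd
  · have h1 : u ^ 3 ^ (j + 1) - v ^ 3 ^ (j + 1) ∣ u ^ (3 ^ (j + 1) * r) - v ^ (3 ^ (j + 1) * r) := by
      rw [pow_mul, pow_mul]; exact sub_dvd_pow_sub_pow _ _ r
    obtain ⟨w, hw⟩ := (dvd_pow_three_pow_sub h2 h6 huv j).trans h1
    have e : ((3 ^ (j + 1) * r : ℕ) : S) = (3 : S) ^ (j + 1) * r := by push_cast; ring
    rw [e, IsUnit.mul_right_dvd hru, hw]
    exact ⟨π ^ 3 * w, by ring⟩

end Algebra

/-! ### §2 The ring `𝓞 = 𝓞_{ℚ₃(ζ₉)}`: `π = 1 − ζ₉`, `π² ∣ 3 ∣ π⁶`, units, lifting `(1 − ζ₉)`-divisible series -/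

/-- `π² ∣ 3` in `𝓞⟦X⟧` (`3 = −π⁶θ⁻¹`, `θ⁻¹ ∈ ℤ[ζ₉]`). [folklore] -/
theorem C_varpi_sq_dvd_three :
    (PowerSeries.C (⟨1 - zeta 9 ℚ_[3] KNine, one_sub_zeta_mem⟩ : ONine)) ^ 2 ∣ (3 : ONine⟦X⟧) := by
  set ϖ : ONine := ⟨1 - zeta 9 ℚ_[3] KNine, one_sub_zeta_mem⟩ with hϖ
  have h3 : (3 : ONine) = ϖ ^ 2 * (-(ϖ ^ 4 * ⟨_, thetaInv_mem⟩)) := by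
    apply Subtype.ext
    push_cast
    rw [three_eq_neg_pow_six_mul_thetaInv zeta_spec]
    ring
  refine ⟨PowerSeries.C (-(ϖ ^ 4 * ⟨_, thetaInv_mem⟩)), ?_⟩
  rw [← map_pow, ← map_mul, ← h3, map_ofNat]

/-- `3 ∣ π⁶` in `𝓞⟦X⟧` (`π⁶ = −3θ`, `θ ∈ ℤ[ζ₉]`). [folklore] -/
theorem three_dvd_C_varpi_pow_six :
    (3 : ONine⟦X⟧) ∣ (PowerSeries.C (⟨1 - zeta 9 ℚ_[3] KNine, one_sub_zeta_mem⟩ : ONine)) ^ 6 := by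
  set ϖ : ONine := ⟨1 - zeta 9 ℚ_[3] KNine, one_sub_zeta_mem⟩ with hϖ
  have h6 : ϖ ^ 6 = 3 * (-⟨_, theta_mem⟩) := by
    apply Subtype.ext
    push_cast
    rw [Summit.BirchSwinnertonDyer.BirchSwinnertonDyer.Theorems.GNine.varpi_pow_six zeta_spec]
    ring
  refine ⟨PowerSeries.C (-⟨_, theta_mem⟩), ?_⟩
  rw [← map_pow, h6, map_mul, map_ofNat]

/-- The integers prime to `3` are units of `𝓞⟦X⟧` (they are units of `ℤ₃ ⊂ 𝓞`). [folklore] -/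
theorem isUnit_natCast_of_not_dvd {r : ℕ} (hr : ¬ 3 ∣ r) : IsUnit (r : ONine⟦X⟧) := by
  have h : IsUnit (r : ℤ_[3]) := by
    rw [PadicInt.isUnit_iff, PadicInt.norm_natCast_eq_one_iff]
    exact (Nat.Prime.coprime_iff_not_dvd (by norm_num)).mpr hr
  have h' : IsUnit (r : ONine) := by simpa using h.map (algebraMap ℤ_[3] ONine)
  simpa using h'.map (PowerSeries.C (R := ONine))

/-- **Lifting a series killed by the reduction map**: if every coefficient of `D ∈ 𝓞⟦X⟧` lies in `ker ρ`, then
`D = (1 − ζ₉)·G` with `G ∈ 𝓞⟦X⟧` (`ker ρ = (1 − ζ₉)𝓞`, `NineIntegers.residueMap_eq_zero_iff`). [folklore] -/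
theorem exists_eq_C_varpi_mul_of_map_eq_zero (ρ : ONine →+* ZMod 3) {D : ONine⟦X⟧}
    (hD : D.map ρ = 0) :
    ∃ G : ONine⟦X⟧, D = PowerSeries.C (⟨1 - zeta 9 ℚ_[3] KNine, one_sub_zeta_mem⟩ : ONine) * G := by
  have hc : ∀ n, ∃ y : ONine, coeff n D = ⟨1 - zeta 9 ℚ_[3] KNine, one_sub_zeta_mem⟩ * y := fun n => by
    have h0 : ρ (coeff n D) = 0 := by
      have := congrArg (coeff n) hD
      rwa [coeff_map, map_zero] at this
    obtain ⟨y, hy, e⟩ := (residueMap_eq_zero_iff ρ (coeff n D)).mp h0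
    exact ⟨⟨y, hy⟩, Subtype.ext (by push_cast; exact e)⟩
  choose g hg using hc
  refine ⟨PowerSeries.mk g, PowerSeries.ext fun n => ?_⟩
  rw [coeff_C_mul, coeff_mk]
  exact hg n

/-! ### §3 The substitution estimate: `3·(ℓ(u) − ℓ(v)) ∈ 𝓞⟦X⟧` for `u ≡ v (mod 1 − ζ₉)` -/

/-- Coefficients of the image of an `𝓞`-series lie in `𝓞`. [folklore] -/
theorem coeff_map_mem (G : ONine⟦X⟧) (n : ℕ) : coeff n (G.map (algebraMap ONine KNine)) ∈ ONine := by
  rw [coeff_map]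
  exact (coeff n G).2

/-- **Katz's key estimate over the ramified ring, after `⊗ ℚ`.** Let `ℓ ∈ ℚ₃(ζ₉)⟦X⟧` have `m·[Xᵐ]ℓ ∈ 𝓞` for
all `m` (e.g. the logarithm of a formal group over `𝓞`), and let `U ≡ V (mod (1 − ζ₉)𝓞⟦X⟧)` be `𝓞`-series
without constant term. Then `3·(ℓ(U) − ℓ(V))` has coefficients in `𝓞`: `ℓ(U) − ℓ(V) = Σₘ [Xᵐ]ℓ·(Uᵐ − Vᵐ)` and
`m ∣ 3(Uᵐ − Vᵐ)` absorbs the denominator `m` of `[Xᵐ]ℓ` (Katz 1981, Key Lemma 5.1.3, with the divided-power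
hypothesis replaced by the valuation estimate `v(πᵐ/m) ≥ −v(3)`). [cite: Katz1981CrystallineDieudonne, Key Lemma 5.1.3]
[cite: Honda1970, §2 Lemma 2.3] -/
theorem three_mul_coeff_subst_sub_subst_mem {ℓ : KNine⟦X⟧} (hℓ : ∀ m : ℕ, (m : KNine) * coeff m ℓ ∈ ONine)
    {U V : ONine⟦X⟧} (hU : constantCoeff U = 0) (hV : constantCoeff V = 0)
    (hUV : PowerSeries.C (⟨1 - zeta 9 ℚ_[3] KNine, one_sub_zeta_mem⟩ : ONine) ∣ U - V) (n : ℕ) :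
    3 * coeff n (ℓ.subst (U.map (algebraMap ONine KNine)) - ℓ.subst (V.map (algebraMap ONine KNine))) ∈
      ONine := by
  set ι := algebraMap ONine KNine with hι
  have hu0 : constantCoeff (U.map ι) = 0 := by
    rw [← coeff_zero_eq_constantCoeff, coeff_map, coeff_zero_eq_constantCoeff, hU, map_zero]
  have hv0 : constantCoeff (V.map ι) = 0 := by
    rw [← coeff_zero_eq_constantCoeff, coeff_map, coeff_zero_eq_constantCoeff, hV, map_zero]
  rw [map_sub, WeierstrassCurve.coeff_subst_eq_sum_range' ℓ hu0 n,
    WeierstrassCurve.coeff_subst_eq_sum_range' ℓ hv0 n, ← Finset.sum_sub_distrib, Finset.mul_sum]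
  refine sum_mem fun m _ => ?_
  -- `3 (Uᵐ − Vᵐ) = m · G`
  obtain ⟨G, hG⟩ := natCast_dvd_three_mul_pow_sub_pow C_varpi_sq_dvd_three three_dvd_C_varpi_pow_six
    (fun r hr => isUnit_natCast_of_not_dvd hr) hUV m
  have key : 3 * (coeff n ((U.map ι) ^ m) - coeff n ((V.map ι) ^ m)) = (m : KNine) * ι (coeff n G) := by
    have h : ι (coeff n (3 * (U ^ m - V ^ m))) = ι (coeff n ((m : ONine⟦X⟧) * G)) := by rw [hG]
    rw [show ((m : ℕ) : ONine⟦X⟧) = PowerSeries.C ((m : ℕ) : ONine) from (map_natCast _ m).symm,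
      show (3 : ONine⟦X⟧) = PowerSeries.C (3 : ONine) from (map_ofNat _ 3).symm, coeff_C_mul, coeff_C_mul,
      map_mul, map_mul, map_natCast, map_ofNat, map_sub, map_sub] at h
    rw [← map_pow, ← map_pow, coeff_map, coeff_map]
    exact h
  rw [← mul_sub, mul_left_comm, key, ← mul_assoc, mul_comm (coeff m ℓ)]
  exact mul_mem (hℓ m) (coeff n G).2

end Summit.BirchSwinnertonDyer.BirchSwinnertonDyer.Theorems.NineHondaEstimate

end
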